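import Summits.QuantumFields.BalabanUV.T4Continuum.Support.DirichletTubeBlock
import Summits.QuantumFields.BalabanUV.T4Continuum.Support.DirichletVertexDecaySum
import Summits.QuantumFields.BalabanUV.T4Continuum.Support.LongitudinalRamp

/-!
# `BalabanUV.T4Continuum.Support.DirichletTubeSum` — NE2 (node U1a) formalisation swarm, sub-row `T4-U1a.S-NE2-D1-DIRICHLET°`, supplier item
# «Δ1-TUBES» (file T4): THE TUBE FAMILY AND ITS BOUNDED OVERLAP — along a longitudinal axis `λ` the tubes are indexed by a 1-D block `b`, a zone
# start `t0 b q = n·b + 2Kq` (`q < Q`, `2K(Q−1) + 4K ≤ n`, zone length `4K`) and a transversal vertex `β′`; every longitudinal coordinate lies in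
# at most TWO zones and every transversal site in at most `2^d` big transversal cubes (file 15), so the zone budgets of file T2 summed over the
# whole family are at most `2^{d+1}` times the global transversal energy and source mass
# (unit b2b-balaban-t4-ne2-formalise-leaf-08, gen 7, file T4)

HONEST FRAMING.  Lattice bookkeeping at MODEL level (finite torus); [folklore]; NE2 (U1a) is NOT proved by this file; spine PROVED 0/9 unchanged;
NOT infinite volume, NOT the mass gap, NOT Clay.  HONEST DEPENDENCY (verbatim): «continuum YM on T⁴ ⇐ BetaPertH ∧ nine spine estimates (0/9
proved); BetaPertH ⇐ (D1) ∧ (D4) ∧ CAP+tail; G-an2-4 gates asym, D1 and NE2/3/4.»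

WHAT THIS FILE PROVES (0 sorry; files T1, 15, 16 and gen 6's slicing BY NAME).  Data `t0`; `blk1_off1_of_lt`, `mem_zone_t0`,
`zone_overlap_le_two`, `sum_zones_le`, `sum_transversal_energy_le`, `sum_transversal_source_le`, and the END **`sum_tube_budgets_le`**.

ABSOLUTE RULE (cell, verbatim): «No internally-minted statement may enter as a cited fact. Every hypothesis is either kernel-proved in
this package or a verbatim quotation of a PUBLISHED theorem with page reference. The manuscript(s) under audit are NOT citable for
their own disputed steps — they are the thing under adjudication; programme-internal (2001/route/tribunal) claims are never citable.»
[folklore]; one data definition; no `def … : Prop` fact.  NOT CLAIMED: the cover, NE2, NE3.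
-/

noncomputable section

open scoped BigOperators ComplexConjugate Matrix
open Finset

namespace Summit.QuantumFields.BalabanUV.T4Continuum.DirichletTubeSum

open Literature.MathematicalPhysics.QuantumFieldTheory.Balaban1983to89.B5Prop11Plancherel (Tor fine)
open Literature.MathematicalPhysics.QuantumFieldTheory.Balaban1983to89.B5Prop11Lower (nsq nsq_nonneg)
open Literature.MathematicalPhysics.QuantumFieldTheory.Balaban1983to89.B5Action121 (sdiff LapS)
open Summit.QuantumFields.BalabanUV.T4Continuum.ScalarAveragedPropagator (dirichlet)
open Summit.QuantumFields.BalabanUV.T4Continuum.DirichletDirectionalBesov (restrictTo)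
open Summit.QuantumFields.BalabanUV.T4Continuum.CoordSlabPoincare (dirOn dirOn_nonneg)
open Summit.QuantumFields.BalabanUV.T4Continuum.DirichletHoleFillingCutoff (chart)
open Summit.QuantumFields.BalabanUV.T4Continuum.DirichletMorreyDecayBlock (cornerBase)
open Summit.QuantumFields.BalabanUV.T4Continuum.DirichletVertexCover (sum_charts_le_two_pow_mul)
open Summit.QuantumFields.BalabanUV.T4Continuum.DirichletVertexDecaySum (sum_normSq_dirOn_big_le)
open Summit.QuantumFields.BalabanUV.T4Continuum.TorusSlicing (Nsl ins zsl sdiff_succAbove_ins sum_torus_slice sum_dir_succAbove)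
open Summit.QuantumFields.BalabanUV.T4Continuum.LongitudinalRamp (lchart zoneL)
open Summit.QuantumFields.BalabanUV.T4Continuum.DirichletTubeBlock (Msl blk1 off1)

variable {d : ℕ} (n : ℕ) [NeZero n] (M : Fin (d + 1) → ℕ) [hM : ∀ μ, NeZero (M μ)] (lam : Fin (d + 1))

/-- the zone start of the `q`-th tube in the 1-D block `b`: `n·b + 2K·q`. [folklore] -/
def t0 (K : ℕ) (b : ZMod (M lam)) (q : ℕ) : ZMod (fine n M lam) := ((n * b.val + 2 * K * q : ℕ) : ZMod (fine n M lam))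

section OneD

variable {n M lam}

/-- 1-D block and offset of `n·b + o`, `o < n`. [folklore] -/
theorem blk1_off1_of_lt (b : ZMod (M lam)) {o : ℕ} (ho : o < n) :
    blk1 n M lam (((n * b.val + o : ℕ) : ZMod (fine n M lam))) = b
      ∧ ((off1 n M lam (((n * b.val + o : ℕ) : ZMod (fine n M lam))) : ℕ) = o) := by
  have hb : b.val < M lam := ZMod.val_lt b
  have hlt : n * b.val + o < fine n M lam := by
    show n * b.val + o < n * M lam
    calc n * b.val + o < n * b.val + n := by omega
      _ = n * (b.val + 1) := by ring
      _ ≤ n * M lam := Nat.mul_le_mul_left n hb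
  have hval : (((n * b.val + o : ℕ) : ZMod (fine n M lam))).val = n * b.val + o := ZMod.val_natCast_of_lt hlt
  have hnpos : 0 < n := Nat.pos_of_ne_zero (NeZero.ne n)
  refine ⟨?_, ?_⟩
  · unfold blk1
    rw [hval, show (n * b.val + o) / n = b.val by
      rw [Nat.add_comm, Nat.add_mul_div_left _ _ hnpos, Nat.div_eq_of_lt ho, Nat.zero_add]]
    exact ZMod.natCast_zmod_val b
  · show (((n * b.val + o : ℕ) : ZMod (fine n M lam))).val % n = o
    rw [hval, Nat.add_comm, Nat.add_mul_mod_self_left, Nat.mod_eq_of_lt ho]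

/-- **membership in a zone, in block coordinates**: `t ∈ zoneL (t0 b q)` (`2Kq + 4K ≤ n`, zone length `nn + 1 = 4K`) forces `blk1 t = b` and
`2Kq ≤ off1 t < 2Kq + 4K`. [folklore] -/
theorem mem_zone_t0 {K nn : ℕ} (hnn : 4 * K = nn + 1) (b : ZMod (M lam)) {q : ℕ} (hq : 2 * K * q + 4 * K ≤ n) {t : ZMod (fine n M lam)}
    (ht : t ∈ zoneL (fine n M) lam (nL := nn) (t0 n M lam K b q)) :
    blk1 n M lam t = b ∧ 2 * K * q ≤ (off1 n M lam t : ℕ) ∧ (off1 n M lam t : ℕ) < 2 * K * q + 4 * K := by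
  rw [zoneL, mem_image] at ht
  obtain ⟨s, -, rfl⟩ := ht
  have hs : (s : ℕ) < 4 * K := by have := s.isLt; omega
  have ho : 2 * K * q + (s : ℕ) < n := by omega
  have e : lchart (fine n M) lam (nL := nn) (t0 n M lam K b q) s = (((n * b.val + (2 * K * q + (s : ℕ)) : ℕ) : ZMod (fine n M lam))) := by
    rw [lchart, t0]; push_cast; ring
  rw [e]
  obtain ⟨h1, h2⟩ := blk1_off1_of_lt b ho
  refine ⟨h1, ?_, ?_⟩ <;> omega

/-- **every longitudinal coordinate lies in at most two zones of the family.** [folklore] -/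
theorem zone_overlap_le_two {K nn : ℕ} (hKpos : 0 < K) (hnn : 4 * K = nn + 1) {Q : ℕ} (hQ : 2 * K * (Q - 1) + 4 * K ≤ n)
    (t : ZMod (fine n M lam)) :
    ∑ b : ZMod (M lam), ∑ q ∈ range Q, (if t ∈ zoneL (fine n M) lam (nL := nn) (t0 n M lam K b q) then (1 : ℝ) else 0) ≤ 2 := by
  classical
  have hq' : ∀ q ∈ range Q, 2 * K * q + 4 * K ≤ n := by
    intro q hq
    rw [mem_range] at hq
    have : 2 * K * q ≤ 2 * K * (Q - 1) := Nat.mul_le_mul_left _ (by omega)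
    omega
  -- only the block of `t` contributes
  rw [Finset.sum_eq_single (blk1 n M lam t)]
  · -- in that block at most two `q`
    set o := (off1 n M lam t : ℕ) with ho
    have hsub : (range Q).filter (fun q => t ∈ zoneL (fine n M) lam (nL := nn) (t0 n M lam K (blk1 n M lam t) q))
        ⊆ ({o / (2 * K) - 1, o / (2 * K)} : Finset ℕ) := by
      intro q hq
      rw [mem_filter] at hq
      obtain ⟨-, h2, h3⟩ := mem_zone_t0 hnn (blk1 n M lam t) (hq' q hq.1) hq.2
      have h2K : 0 < 2 * K := by omega
      have hle : q ≤ o / (2 * K) := (Nat.le_div_iff_mul_le h2K).mpr (by rw [mul_comm]; exact h2)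
      have hge : o / (2 * K) < q + 2 := (Nat.div_lt_iff_lt_mul h2K).mpr (by nlinarith)
      rw [mem_insert, mem_singleton]
      omega
    rw [← Finset.sum_filter]
    calc ∑ q ∈ (range Q).filter (fun q => t ∈ zoneL (fine n M) lam (nL := nn) (t0 n M lam K (blk1 n M lam t) q)), (1 : ℝ)
        = ((range Q).filter (fun q => t ∈ zoneL (fine n M) lam (nL := nn) (t0 n M lam K (blk1 n M lam t) q))).card := by simp
      _ ≤ (({o / (2 * K) - 1, o / (2 * K)} : Finset ℕ).card : ℝ) := by exact_mod_cast Finset.card_le_card hsub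
      _ ≤ 2 := by exact_mod_cast Finset.card_le_two
  · intro b _ hb
    refine Finset.sum_eq_zero fun q hq => ?_
    rw [if_neg]
    intro ht
    exact hb (mem_zone_t0 hnn b (hq' q hq) ht).1.symm
  · intro h; exact absurd (mem_univ _) h

/-- **summing a non-negative longitudinal quantity over all zones costs a factor 2.** [folklore] -/
theorem sum_zones_le {K nn : ℕ} (hKpos : 0 < K) (hnn : 4 * K = nn + 1) {Q : ℕ} (hQ : 2 * K * (Q - 1) + 4 * K ≤ n)
    {X : ZMod (fine n M lam) → ℝ} (hX : ∀ t, 0 ≤ X t) :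
    ∑ b : ZMod (M lam), ∑ q ∈ range Q, ∑ t ∈ zoneL (fine n M) lam (nL := nn) (t0 n M lam K b q), X t ≤ 2 * ∑ t, X t := by
  classical
  have e : ∀ (b : ZMod (M lam)) (q : ℕ), ∑ t ∈ zoneL (fine n M) lam (nL := nn) (t0 n M lam K b q), X t
      = ∑ t, (if t ∈ zoneL (fine n M) lam (nL := nn) (t0 n M lam K b q) then (1 : ℝ) else 0) * X t := by
    intro b q
    simp_rw [boole_mul]
    rw [Finset.sum_ite_mem, Finset.univ_inter]
  simp_rw [e]
  calc ∑ b : ZMod (M lam), ∑ q ∈ range Q, ∑ t, (if t ∈ zoneL (fine n M) lam (nL := nn) (t0 n M lam K b q) then (1 : ℝ) else 0) * X t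
      = ∑ b : ZMod (M lam), ∑ t, ∑ q ∈ range Q, (if t ∈ zoneL (fine n M) lam (nL := nn) (t0 n M lam K b q) then (1 : ℝ) else 0) * X t :=
        Finset.sum_congr rfl fun b _ => Finset.sum_comm
    _ = ∑ t, ∑ b : ZMod (M lam), ∑ q ∈ range Q, (if t ∈ zoneL (fine n M) lam (nL := nn) (t0 n M lam K b q) then (1 : ℝ) else 0) * X t :=
        Finset.sum_comm
    _ = ∑ t, (∑ b : ZMod (M lam), ∑ q ∈ range Q, (if t ∈ zoneL (fine n M) lam (nL := nn) (t0 n M lam K b q) then (1 : ℝ) else 0)) * X t := by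
        refine Finset.sum_congr rfl fun t _ => ?_
        rw [Finset.sum_mul]
        exact Finset.sum_congr rfl fun b _ => by rw [Finset.sum_mul]
    _ ≤ ∑ t, 2 * X t := Finset.sum_le_sum fun t _ => mul_le_mul_of_nonneg_right (zone_overlap_le_two hKpos hnn hQ t) (hX t)
    _ = 2 * ∑ t, X t := by rw [Finset.mul_sum]

end OneD

/-! ## Transversal overlap, slice by slice -/

section Transversal

variable {n M lam}

/-- per slice: the big-cube transversal energies summed over all transversal vertices ≤ `2^d ×` the transversal energy of the slice. [folklore] -/
theorem sum_transversal_energy_le {K nn : ℕ} (hK : 2 * K ≤ n) (hnn : 4 * K = nn + 1) (hN' : ∀ ν, nn + 1 ≤ fine n (Msl M lam) ν)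
    (z : Tor (fine n M) → ℂ) (t : ZMod (fine n M lam)) :
    ∑ β' : Tor (Msl M lam), (n : ℝ) ^ 2 * dirOn (univ : Finset (Fin d → Fin (nn + 1)))
        (zsl (fine n M) lam z t ∘ chart (fine n (Msl M lam)) (n := nn) (cornerBase n (Msl M lam) β' K))
      ≤ 2 ^ d * ∑ i : Fin d, ∑ y : Tor (fine n (Msl M lam)), ‖(sdiff (fine n M) (n : ℂ) (lam.succAbove i) *ᵥ z) (ins (fine n M) lam t y)‖ ^ 2 := by
  have h := sum_normSq_dirOn_big_le hK hnn hN' (zsl (fine n M) lam z t)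
  refine h.trans (le_of_eq ?_)
  congr 1
  rw [dirichlet]
  refine Finset.sum_congr rfl fun i _ => ?_
  rw [nsq]
  refine Finset.sum_congr rfl fun y _ => ?_
  rw [sdiff_succAbove_ins]
  rfl

/-- per slice: the big-cube source masses summed over all transversal vertices ≤ `2^d ×` the source mass of the slice. [folklore] -/
theorem sum_transversal_source_le {K nn : ℕ} (hK : 2 * K ≤ n) (hnn : 4 * K = nn + 1) (hN' : ∀ ν, nn + 1 ≤ fine n (Msl M lam) ν)
    (F : Tor (fine n M) → ℂ) (t : ZMod (fine n M lam)) :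
    ∑ β' : Tor (Msl M lam), ∑ j : Fin d → Fin (nn + 1), ‖F (ins (fine n M) lam t (chart (fine n (Msl M lam)) (cornerBase n (Msl M lam) β' K) j))‖ ^ 2
      ≤ 2 ^ d * ∑ y : Tor (fine n (Msl M lam)), ‖F (ins (fine n M) lam t y)‖ ^ 2 :=
  sum_charts_le_two_pow_mul hK hnn hN' (G := fun y => ‖F (ins (fine n M) lam t y)‖ ^ 2) (fun _ => sq_nonneg _)

end Transversal

/-! ## The END: the zone budgets summed over the tube family -/

section End

variable {n M lam}

/-- **THE ZONE BUDGETS OF THE WHOLE TUBE FAMILY** (along one axis `λ`): with `K ≥ 1`, `2K ≤ n`, `4K = nn + 1 ≤ n·M′ ν`, `2K(Q−1) + 4K ≤ n`, for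
every field `z`, every family of transversal vertex sets `A b ⊆ Tor M′` and constants `c₁, c₂ ≥ 0`:
`Σ_b Σ_{q<Q} Σ_{β′ ∈ A b} (c₁·Σ_{t∈zone} n²·dirOn(big slice) + c₂·Σ_{t∈zone}Σ_j ‖F(ins t (chart big j))‖²)
 ≤ 2^{d+1}·(c₁·Σ_i ‖∂_{succAbove i} z‖² + c₂·Σ_x ‖F x‖²)`. [folklore] -/
theorem sum_tube_budgets_le {K nn : ℕ} (hKpos : 0 < K) (hK : 2 * K ≤ n) (hnn : 4 * K = nn + 1) (hN' : ∀ ν, nn + 1 ≤ fine n (Msl M lam) ν)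
    {Q : ℕ} (hQ : 2 * K * (Q - 1) + 4 * K ≤ n) (z F : Tor (fine n M) → ℂ) (A : ZMod (M lam) → Finset (Tor (Msl M lam)))
    {c₁ c₂ : ℝ} (hc₁ : 0 ≤ c₁) (hc₂ : 0 ≤ c₂) :
    ∑ b : ZMod (M lam), ∑ q ∈ range Q, ∑ β' ∈ A b,
        (c₁ * ∑ t ∈ zoneL (fine n M) lam (nL := nn) (t0 n M lam K b q), (n : ℝ) ^ 2 * dirOn (univ : Finset (Fin d → Fin (nn + 1)))
            (zsl (fine n M) lam z t ∘ chart (fine n (Msl M lam)) (n := nn) (cornerBase n (Msl M lam) β' K))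
          + c₂ * ∑ t ∈ zoneL (fine n M) lam (nL := nn) (t0 n M lam K b q), ∑ j : Fin d → Fin (nn + 1),
            ‖F (ins (fine n M) lam t (chart (fine n (Msl M lam)) (cornerBase n (Msl M lam) β' K) j))‖ ^ 2)
      ≤ 2 ^ (d + 1) * (c₁ * ∑ i : Fin d, nsq (sdiff (fine n M) (n : ℂ) (lam.succAbove i) *ᵥ z) + c₂ * ∑ x, ‖F x‖ ^ 2) := by
  -- per (b, q): sum over `β′ ∈ A b` ≤ sum over all `β′`, then the transversal overlap slice by slice
  set E : ZMod (fine n M lam) → ℝ := fun t => ∑ i : Fin d, ∑ y : Tor (fine n (Msl M lam)),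
    ‖(sdiff (fine n M) (n : ℂ) (lam.succAbove i) *ᵥ z) (ins (fine n M) lam t y)‖ ^ 2 with hE
  set G : ZMod (fine n M lam) → ℝ := fun t => ∑ y : Tor (fine n (Msl M lam)), ‖F (ins (fine n M) lam t y)‖ ^ 2 with hG
  have hE0 : ∀ t, 0 ≤ E t := fun t => Finset.sum_nonneg fun _ _ => Finset.sum_nonneg fun _ _ => sq_nonneg _
  have hG0 : ∀ t, 0 ≤ G t := fun t => Finset.sum_nonneg fun _ _ => sq_nonneg _
  have hbq : ∀ (b : ZMod (M lam)) (q : ℕ), ∑ β' ∈ A b,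
        (c₁ * ∑ t ∈ zoneL (fine n M) lam (nL := nn) (t0 n M lam K b q), (n : ℝ) ^ 2 * dirOn (univ : Finset (Fin d → Fin (nn + 1)))
            (zsl (fine n M) lam z t ∘ chart (fine n (Msl M lam)) (n := nn) (cornerBase n (Msl M lam) β' K))
          + c₂ * ∑ t ∈ zoneL (fine n M) lam (nL := nn) (t0 n M lam K b q), ∑ j : Fin d → Fin (nn + 1),
            ‖F (ins (fine n M) lam t (chart (fine n (Msl M lam)) (cornerBase n (Msl M lam) β' K) j))‖ ^ 2)
      ≤ ∑ t ∈ zoneL (fine n M) lam (nL := nn) (t0 n M lam K b q), 2 ^ d * (c₁ * E t + c₂ * G t) := by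
    intro b q
    have hterm : ∀ β' : Tor (Msl M lam), 0 ≤
        c₁ * ∑ t ∈ zoneL (fine n M) lam (nL := nn) (t0 n M lam K b q), (n : ℝ) ^ 2 * dirOn (univ : Finset (Fin d → Fin (nn + 1)))
            (zsl (fine n M) lam z t ∘ chart (fine n (Msl M lam)) (n := nn) (cornerBase n (Msl M lam) β' K))
          + c₂ * ∑ t ∈ zoneL (fine n M) lam (nL := nn) (t0 n M lam K b q), ∑ j : Fin d → Fin (nn + 1),
            ‖F (ins (fine n M) lam t (chart (fine n (Msl M lam)) (cornerBase n (Msl M lam) β' K) j))‖ ^ 2 := by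
      intro β'
      refine add_nonneg (mul_nonneg hc₁ (Finset.sum_nonneg fun _ _ => mul_nonneg (sq_nonneg _) (dirOn_nonneg _ _)))
        (mul_nonneg hc₂ (Finset.sum_nonneg fun _ _ => Finset.sum_nonneg fun _ _ => sq_nonneg _))
    refine (Finset.sum_le_sum_of_subset_of_nonneg (Finset.subset_univ (A b)) (fun β' _ _ => hterm β')).trans ?_
    have hT1 : ∑ β' : Tor (Msl M lam), c₁ * ∑ t ∈ zoneL (fine n M) lam (nL := nn) (t0 n M lam K b q), (n : ℝ) ^ 2
          * dirOn (univ : Finset (Fin d → Fin (nn + 1))) (zsl (fine n M) lam z t ∘ chart (fine n (Msl M lam)) (n := nn) (cornerBase n (Msl M lam) β' K))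
        ≤ c₁ * ∑ t ∈ zoneL (fine n M) lam (nL := nn) (t0 n M lam K b q), 2 ^ d * E t := by
      rw [← Finset.mul_sum, Finset.sum_comm]
      exact mul_le_mul_of_nonneg_left (Finset.sum_le_sum fun t _ => sum_transversal_energy_le (lam := lam) hK hnn hN' z t) hc₁
    have hT2 : ∑ β' : Tor (Msl M lam), c₂ * ∑ t ∈ zoneL (fine n M) lam (nL := nn) (t0 n M lam K b q), ∑ j : Fin d → Fin (nn + 1),
          ‖F (ins (fine n M) lam t (chart (fine n (Msl M lam)) (cornerBase n (Msl M lam) β' K) j))‖ ^ 2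
        ≤ c₂ * ∑ t ∈ zoneL (fine n M) lam (nL := nn) (t0 n M lam K b q), 2 ^ d * G t := by
      rw [← Finset.mul_sum, Finset.sum_comm]
      exact mul_le_mul_of_nonneg_left (Finset.sum_le_sum fun t _ => sum_transversal_source_le (lam := lam) hK hnn hN' F t) hc₂
    rw [Finset.sum_add_distrib]
    refine (add_le_add hT1 hT2).trans (le_of_eq ?_)
    rw [Finset.mul_sum, Finset.mul_sum, ← Finset.sum_add_distrib]
    exact Finset.sum_congr rfl fun t _ => by ring
  refine (Finset.sum_le_sum fun b _ => Finset.sum_le_sum fun q _ => hbq b q).trans ?_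
  have hzones := sum_zones_le (lam := lam) hKpos hnn hQ (X := fun t => 2 ^ d * (c₁ * E t + c₂ * G t))
    (fun t => by positivity)
  refine hzones.trans (le_of_eq ?_)
  -- `Σ_t E t = Σ_i nsq(∂_{succAbove i} z)`, `Σ_t G t = Σ_x ‖F x‖²`
  have hEsum : ∑ t, E t = ∑ i : Fin d, nsq (sdiff (fine n M) (n : ℂ) (lam.succAbove i) *ᵥ z) := by
    rw [hE, Finset.sum_comm]
    refine Finset.sum_congr rfl fun i _ => ?_
    rw [nsq, sum_torus_slice (fine n M) lam]
    try rfl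
  have hGsum : ∑ t, G t = ∑ x, ‖F x‖ ^ 2 := by
    rw [hG, sum_torus_slice (fine n M) lam]
    try rfl
  rw [← Finset.mul_sum, Finset.sum_add_distrib, ← Finset.mul_sum, ← Finset.mul_sum, hEsum, hGsum, pow_succ]
  ring

end End

end Summit.QuantumFields.BalabanUV.T4Continuum.DirichletTubeSum

end
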